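import Mathlib
import HarnessLib
import Summits.HubbardSuperconductivity.HubbardSuperconductivity.Theorems.KLProgrammeKLRegimeEngineSixLegInputFamilyCells

/-!
# K3 ENGINE child `KLRegimeEngineV17F2` (stmt-HubbardSuperconductivity-20437), stub (b) closing path, WEIGHTED track: TWO- AND FOUR-LEG CELLS AT THE INPUT FAMILY
# (cell gate-hubbard-kl, seat hubbard-kl-k3c2-p3 g18, row «sector-counting import»; located item «(b)-WT4-2LEG-PLAIN-CURRENCY» / cure «(C1″)», KL STATUS 2026-08-29 ≈12:30Z)

The W-tower's kit reads the two- and four-leg MEASURED sizes of every block input `𝒱_{dk}[K] = klTowerInput … d k` at the INPUT family `F_{dk−1}`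
(`klTowerMeasWtAt … d k j 2 / 4`, rows `W·Z·(meas₂/klLevUnitF 0 1 (dk−1)) ≤ ι₁·λ`, `W·Z²·(meas₄/klLevUnitF 0 2 (dk−1)) ≤ ι₂·λ`).  The assemblies so far
fed these rows from PLAIN (`trivialMultiplier`) weighted lines of the 2- and 4-kernels of `𝒱_{dk}[K]` over ALL frequency–momenta (this lineage's
`importBindersWt_of_wplainLines_flow_all`).  At TWO legs that currency is vacuous at deep blocks: by `TorusFourierL2.fixedTupleL1_two_eq_of_conserving`
and torus Fourier inversion the plain line dominates `βL²·‖κ‖·sup_{(k₀,k)}|f(k₀,k)|`, the supremum over ALL frequency–momenta of the two-leg symbol of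
`𝒱_{dk}[K_n]`, whose frequency dependence (the generated self-energy above `Λ_{dk}` at order-one Matsubara frequencies; the frame `K_n` is
frequency-independent) does not decay like `4^{−dk}` — while the row's right side `S₂·4^{−(dk−1)}` does.  The sound object is the SECTORISED two-leg size at
the input family (frequency–momenta with `t < Λ_{dk−1}` only), i.e. exactly what the kit consumes.  This file is the `m = 2` / `m = 4` twin of
`…EngineSixLegInputFamilyCells` §1 (p715234):

* §1 (generic degree) `klWtPinnedSumAt_klTowerInput_le_of_inputFamilyCell`, `klTowerMeasWtAt_le_of_inputFamilyCell` — an input-family cell of degree `m`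
  bounds every rate-`j ≥ dk−1` pinned sum of `𝒱_{dk}` at `F_{dk−1}` and the measured array;
* §2 the floor units at tracks `p = 1, 2`: `klLevUnitF_zero_one_eq` (`ε·(4^J)⁻¹`), `klLevUnitF_zero_two_eq` (`ε³·2^J`);
* §3 **`importRowTwo_of_inputFamilyCell`** — cell `klWtPinnedSumOf … (dk−1) 2 (𝒱_{dk}) q w ≤ S₂·(4^{dk−1})⁻¹` ⇒ `W·Z·(meas₂/klLevUnitF 0 1 (dk−1)) ≤ 2·W·Z·S₂·(M/β)`
  (the tower's two-leg import row with `ι₁·λ := 2·W·Z·S₂·(M/β)`, c-class and RATE-FREE as (R403) «E-b1-2LEG-SHAPE» wants);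
* §4 **`importRowFour_of_inputFamilyCell`** — cell `klWtPinnedSumOf … (dk−1) 4 (𝒱_{dk}) q w ≤ S₄·λ·2^{dk−1}` ⇒ `W·Z²·(meas₄/klLevUnitF 0 2 (dk−1)) ≤ 8·W·Z²·S₄·(M/β)³·λ`.
Compositions of landed definitions and real arithmetic; nothing about the model is asserted; the cells stay hypotheses (E1); nothing asserts (b), any stub, K3
or superconductivity.  References: BGM 2006 §2.8 (2.76)–(2.77), (2.81) [cite: BenfattoGiulianiMastropietro2006].
-/

noncomputable section

namespace Summit.HubbardSuperconductivity.HubbardSuperconductivity.Theorems.EngineV8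

set_option linter.dupNamespace false -- summit = problem name (single-conjunct summit), D-0017

open Classical
open Real Finset Literature.MathematicalPhysics.QuantumLattice Literature.Probability.LatticeModels GrassmannAlgebra
open Literature.MathematicalPhysics.QuantumLattice.FermiRG
open Summit.HubbardSuperconductivity.HubbardSuperconductivity.Theorems.KLRegimeSplit
open Summit.HubbardSuperconductivity.HubbardSuperconductivity.Theorems.KLProgrammeLegKernels
open Summit.HubbardSuperconductivity.HubbardSuperconductivity.Theorems.DispersionFlow

variable {L M : ℕ} [NeZero L] [NeZero M]

/-! ## §1 An input-family cell of any degree IS the tower's measured array of that degree -/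

omit [NeZero M] in
/-- **An input-family cell bounds every rate-`j ≥ dk−1` pinned sum of block `k`'s input at `F_{dk−1}`** (degree `m`; `klTowerInput` is
`klEffectiveAction … (d·k)` by `rfl`; the rate only lowers the weight, `klWtPinnedSumAt_le_klWtPinnedSumOf`). [cite: BenfattoGiulianiMastropietro2006, §2.8 (2.77)] -/
theorem klWtPinnedSumAt_klTowerInput_le_of_inputFamilyCell {β : ℝ} (hβ : 0 ≤ β) (U μ : ℝ) (K : TrigPolyC4v) (d k m : ℕ) {j : ℕ}
    (hj : d * k - 1 ≤ j) {B : ℝ}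
    (hcell : ∀ (q : Fin m) (w : SpaceTimeIdx L M × SectorLeg (sectorCount (d * k - 1))),
      klWtPinnedSumOf L M β μ K (d * k - 1) m (klEffectiveAction L M β U μ K klE0 (d * k)) q w ≤ B)
    (q : Fin m) (w : SpaceTimeIdx L M × SectorLeg (sectorCount (d * k - 1))) :
    klWtPinnedSumAt L M β μ K (d * k - 1) j m (klTowerInput L M β U μ K d k) q w ≤ B :=
  (klWtPinnedSumAt_le_klWtPinnedSumOf hβ μ K hj m _ q w).trans (hcell q w)

omit [NeZero M] in
/-- **An input-family cell bounds the measured array of block `k`** in its degree: `klTowerMeasWtAt … d k j m ≤ B` for every rate `j ≥ dk − 1` (`0 ≤ B`).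
[cite: BenfattoGiulianiMastropietro2006, §2.8 (2.77)] -/
theorem klTowerMeasWtAt_le_of_inputFamilyCell {β : ℝ} (hβ : 0 ≤ β) (U μ : ℝ) (K : TrigPolyC4v) (d k m : ℕ) {j : ℕ}
    (hj : d * k - 1 ≤ j) {B : ℝ} (hB : 0 ≤ B)
    (hcell : ∀ (q : Fin m) (w : SpaceTimeIdx L M × SectorLeg (sectorCount (d * k - 1))),
      klWtPinnedSumOf L M β μ K (d * k - 1) m (klEffectiveAction L M β U μ K klE0 (d * k)) q w ≤ B) :
    klTowerMeasWtAt L M β U μ K d k j m ≤ B := by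
  unfold klTowerMeasWtAt
  rcases isEmpty_or_nonempty (Fin m × (SpaceTimeIdx L M × SectorLeg (sectorCount (d * k - 1)))) with he | he
  · rw [Real.iSup_of_isEmpty]; exact hB
  · exact ciSup_le fun qw => klWtPinnedSumAt_klTowerInput_le_of_inputFamilyCell hβ U μ K d k m hj hcell qw.1 qw.2

/-! ## §2 The floor units at tracks `p = 1` and `p = 2` -/

omit [NeZero L] [NeZero M] in
/-- **The two-leg floor unit at track `0`**: `klLevUnitF β M 0 1 J = ε·(4^J)⁻¹`. -/
theorem klLevUnitF_zero_one_eq (β : ℝ) (M : ℕ) (J : ℕ) : klLevUnitF β M 0 1 J = imagTimeWeight β M * ((4 : ℝ) ^ J)⁻¹ := by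
  unfold klLevUnitF
  have hg : klLevGain (0 : Fin 5) * J = 0 := by rw [show klLevGain (0 : Fin 5) = 0 from rfl, zero_mul]
  have h8 : (2 : ℝ) ^ (5 * J) = (8 : ℝ) ^ (J * 1) * (4 : ℝ) ^ J := by
    rw [show (8 : ℝ) = 2 ^ 3 by norm_num, show (4 : ℝ) = 2 ^ 2 by norm_num, ← pow_mul, ← pow_mul, ← pow_add]; congr 1; ring
  rw [show 2 * 1 - 1 = 1 from rfl, pow_one, h8, hg, pow_zero, mul_one]
  have h8' : (8 : ℝ) ^ (J * 1) ≠ 0 := pow_ne_zero _ (by norm_num)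
  have h4 : (4 : ℝ) ^ J ≠ 0 := pow_ne_zero _ (by norm_num)
  field_simp

omit [NeZero L] [NeZero M] in
/-- **The four-leg floor unit at track `0`**: `klLevUnitF β M 0 2 J = ε³·2^J`. -/
theorem klLevUnitF_zero_two_eq (β : ℝ) (M : ℕ) (J : ℕ) : klLevUnitF β M 0 2 J = imagTimeWeight β M ^ 3 * (2 : ℝ) ^ J := by
  unfold klLevUnitF
  have hg : klLevGain (0 : Fin 5) * J = 0 := by rw [show klLevGain (0 : Fin 5) = 0 from rfl, zero_mul]
  have h8 : (8 : ℝ) ^ (J * 2) = (2 : ℝ) ^ (5 * J) * (2 : ℝ) ^ J := by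
    rw [show (8 : ℝ) = 2 ^ 3 by norm_num, ← pow_mul, ← pow_add]; congr 1; ring
  rw [show 2 * 2 - 1 = 3 from rfl, h8, hg, pow_zero, mul_one]
  have h5 : (2 : ℝ) ^ (5 * J) ≠ 0 := pow_ne_zero _ two_ne_zero
  field_simp

/-! ## §3 The two-leg import row from an input-family cell -/

/-- **THE TWO-LEG IMPORT ROW OF THE W-LAW FROM AN INPUT-FAMILY CELL** («(C1″)»; rate `j ≥ dk−1`, `0 ≤ W, Z, S₂`, `0 < β`): if
`∀ q w, klWtPinnedSumOf … (dk−1) 2 (klEffectiveAction … klE0 (dk)) q w ≤ S₂·(4^{dk−1})⁻¹` then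
`W·Z^1·(klTowerMeasWtAt … d k j 2 / klLevUnitF β M 0 1 (dk−1)) ≤ 2·W·Z·S₂·(M/β)` (`klLevUnitF_zero_one_eq`: unit `ε·(4^{dk−1})⁻¹`, `1/ε = 2·(M/β)`) — the kit's
two-leg row with `ι₁·λ := 2·W·Z·S₂·(M/β)`, rate-free. [cite: BenfattoGiulianiMastropietro2006, §2.8 (2.77)] -/
theorem importRowTwo_of_inputFamilyCell {β : ℝ} (hβ : 0 < β) (U μ : ℝ) (K : TrigPolyC4v) (d k : ℕ) {j : ℕ}
    (hj : d * k - 1 ≤ j) {W Z S₂ : ℝ} (hW : 0 ≤ W) (hZ : 0 ≤ Z) (hS₂ : 0 ≤ S₂)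
    (hcell : ∀ (q : Fin 2) (w : SpaceTimeIdx L M × SectorLeg (sectorCount (d * k - 1))),
      klWtPinnedSumOf L M β μ K (d * k - 1) 2 (klEffectiveAction L M β U μ K klE0 (d * k)) q w ≤ S₂ * ((4 : ℝ) ^ (d * k - 1))⁻¹) :
    W * Z ^ 1 * (klTowerMeasWtAt L M β U μ K d k j 2 / klLevUnitF β M 0 1 (d * k - 1)) ≤ 2 * W * Z * S₂ * ((M : ℝ) / β) := by
  have hM0 : (0 : ℝ) < M := Nat.cast_pos.2 (Nat.pos_of_ne_zero (NeZero.ne M))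
  have h40 : (0 : ℝ) < (4 : ℝ) ^ (d * k - 1) := by positivity
  have hB : 0 ≤ S₂ * ((4 : ℝ) ^ (d * k - 1))⁻¹ := by positivity
  have hA := klTowerMeasWtAt_le_of_inputFamilyCell hβ.le U μ K d k 2 hj hB hcell
  have hu : 0 < klLevUnitF β M 0 1 (d * k - 1) := klLevUnitF_pos hβ 0 1 (d * k - 1)
  have hr : ((M : ℝ) / β) * imagTimeWeight β M = 1 / 2 := by
    unfold imagTimeWeight; field_simp
  rw [pow_one, mul_div_assoc', div_le_iff₀ hu, klLevUnitF_zero_one_eq]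
  calc W * Z * klTowerMeasWtAt L M β U μ K d k j 2 ≤ W * Z * (S₂ * ((4 : ℝ) ^ (d * k - 1))⁻¹) :=
        mul_le_mul_of_nonneg_left hA (by positivity)
    _ = 2 * W * Z * S₂ * ((M : ℝ) / β) * (imagTimeWeight β M * ((4 : ℝ) ^ (d * k - 1))⁻¹) := by
        linear_combination (-(2 * W * Z * S₂ * ((4 : ℝ) ^ (d * k - 1))⁻¹)) * hr

/-- **The two-leg import row, rate-indexed product face** (`λ > 0`): the same cell gives `W·Z^1·(meas₂/unit) ≤ (2·W·Z·S₂·(M/β)/λ)·λ` — the shape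
`ι₁ j·λ_j` with `ι₁ j := 2·W·Z·S₂·(M/β)/λ_j`. [cite: BenfattoGiulianiMastropietro2006, §2.8 (2.77)] -/
theorem importRowTwo_of_inputFamilyCell_rate {β : ℝ} (hβ : 0 < β) (U μ : ℝ) (K : TrigPolyC4v) (d k : ℕ) {j : ℕ}
    (hj : d * k - 1 ≤ j) {W Z S₂ lam : ℝ} (hW : 0 ≤ W) (hZ : 0 ≤ Z) (hS₂ : 0 ≤ S₂) (hlam : 0 < lam)
    (hcell : ∀ (q : Fin 2) (w : SpaceTimeIdx L M × SectorLeg (sectorCount (d * k - 1))),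
      klWtPinnedSumOf L M β μ K (d * k - 1) 2 (klEffectiveAction L M β U μ K klE0 (d * k)) q w ≤ S₂ * ((4 : ℝ) ^ (d * k - 1))⁻¹) :
    W * Z ^ 1 * (klTowerMeasWtAt L M β U μ K d k j 2 / klLevUnitF β M 0 1 (d * k - 1)) ≤ (2 * W * Z * S₂ * ((M : ℝ) / β) / lam) * lam := by
  rw [div_mul_cancel₀ _ hlam.ne']
  exact importRowTwo_of_inputFamilyCell hβ U μ K d k hj hW hZ hS₂ hcell

/-! ## §4 The four-leg import row from an input-family cell -/

/-- **THE FOUR-LEG IMPORT ROW OF THE W-LAW FROM AN INPUT-FAMILY CELL** (rate `j ≥ dk−1`, `0 ≤ W, S₄, λ`, `0 < β`): if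
`∀ q w, klWtPinnedSumOf … (dk−1) 4 (klEffectiveAction … klE0 (dk)) q w ≤ S₄·λ·2^{dk−1}` then
`W·Z²·(klTowerMeasWtAt … d k j 4 / klLevUnitF β M 0 2 (dk−1)) ≤ 8·W·Z²·S₄·(M/β)³·λ` (`klLevUnitF_zero_two_eq`: unit `ε³·2^{dk−1}`, `1/ε³ = 8·(M/β)³`) — the kit's
four-leg row with `ι₂ := 8·W·Z²·S₄·(M/β)³`. [cite: BenfattoGiulianiMastropietro2006, §2.8 (2.77), (2.81)] -/
theorem importRowFour_of_inputFamilyCell {β : ℝ} (hβ : 0 < β) (U μ : ℝ) (K : TrigPolyC4v) (d k : ℕ) {j : ℕ}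
    (hj : d * k - 1 ≤ j) {W Z S₄ lam : ℝ} (hW : 0 ≤ W) (hS₄ : 0 ≤ S₄) (hlam : 0 ≤ lam)
    (hcell : ∀ (q : Fin 4) (w : SpaceTimeIdx L M × SectorLeg (sectorCount (d * k - 1))),
      klWtPinnedSumOf L M β μ K (d * k - 1) 4 (klEffectiveAction L M β U μ K klE0 (d * k)) q w ≤ S₄ * lam * (2 : ℝ) ^ (d * k - 1)) :
    W * Z ^ 2 * (klTowerMeasWtAt L M β U μ K d k j 4 / klLevUnitF β M 0 2 (d * k - 1)) ≤ 8 * W * Z ^ 2 * S₄ * ((M : ℝ) / β) ^ 3 * lam := by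
  have hM0 : (0 : ℝ) < M := Nat.cast_pos.2 (Nat.pos_of_ne_zero (NeZero.ne M))
  have hB : 0 ≤ S₄ * lam * (2 : ℝ) ^ (d * k - 1) := by positivity
  have hA := klTowerMeasWtAt_le_of_inputFamilyCell hβ.le U μ K d k 4 hj hB hcell
  have hu : 0 < klLevUnitF β M 0 2 (d * k - 1) := klLevUnitF_pos hβ 0 2 (d * k - 1)
  have hr : ((M : ℝ) / β) * imagTimeWeight β M = 1 / 2 := by
    unfold imagTimeWeight; field_simp
  have hr3 : ((M : ℝ) / β) ^ 3 * imagTimeWeight β M ^ 3 = 1 / 8 := by rw [← mul_pow, hr]; norm_num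
  rw [mul_div_assoc', div_le_iff₀ hu, klLevUnitF_zero_two_eq]
  calc W * Z ^ 2 * klTowerMeasWtAt L M β U μ K d k j 4 ≤ W * Z ^ 2 * (S₄ * lam * (2 : ℝ) ^ (d * k - 1)) :=
        mul_le_mul_of_nonneg_left hA (by positivity)
    _ = 8 * W * Z ^ 2 * S₄ * ((M : ℝ) / β) ^ 3 * lam * (imagTimeWeight β M ^ 3 * (2 : ℝ) ^ (d * k - 1)) := by
        linear_combination (-(8 * W * Z ^ 2 * S₄ * lam * (2 : ℝ) ^ (d * k - 1))) * hr3

end Summit.HubbardSuperconductivity.HubbardSuperconductivity.Theorems.EngineV8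

end
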